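import Summits.QuantumFields.BalabanUV.T4Continuum.Support.NE9LinSizeEndMultiScale
import Summits.QuantumFields.BalabanUV.T4Continuum.Support.NE9LinSizeEndBudget

/-!
# NE9LinSizeEndMultiScaleBudget — N2-quater: the leaf-01 budget APPLIED to the multi-scale END face E5′-ms
(`NE9LinSizeEndMultiScale.msChart_termSize_ne9_and_fadingMemory_of_linSizeDischargers`, p211220): the bookkeeping scalars `a₁`,
`lip`, `lipbar` of the face are CHOSEN (the witnesses of N2-ter §C `NE9LinSizeEndBudget.fade_sufficient_E5'` made explicit) and its
binders `ha₁ hlip hlipb hliplb hsmall hpos hrate hNsucc` DISCHARGED from four PRINT-SHAPED scalar conditions, leaving an END face whose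
rate letter is an explicit POLYNOMIAL in the table letters — cell `pub-balaban`, T4-DAG §2 node U3 / §6 NE9; lineage item of unit
`b2b-balaban-t4-ne9-formalise-leaf-01` (gen 3; journal CLAIM l.7907; invited by leaf-05-g2 l.7503 and leaf-10-g3 l.7769).

HONEST FRAMING (T4-DAG PAGE 1).  Rung (B)+1 on a FIXED finite torus — NOT infinite volume, NOT a mass gap, NOT the Clay problem.
NE9 is a cell NEW ESTIMATE, NOT PRINTED, and is NOT discharged here: this module is OUR OWN bookkeeping (real arithmetic on displayed
binder shapes composed with an END face BY NAME); every analytic input of E5′-ms stays a DISPLAYED binder ((A″) TYPE (2.38), (L‴)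
TYPE (2.20), the recursion side, the read-out); [I]/[II] are quoted for TYPES only (ABSOLUTE RULE: nothing printed is asserted);
`FlowStep.BetaPertH`, (B), (B^μ) do not occur; 0 `def`, 0 sorry, no END re-wired (a corollary face beside E5′-ms).  HONEST DEPENDENCY
(verbatim): continuum YM on T⁴ ⇐ BetaPertH ∧ nine spine estimates (0/9 proved); BetaPertH ⇐ (D1) ∧ (D4) ∧ CAP+tail; G-an2-4 gates
asym, D1 and NE2/3/4.

WHY.  The census inequalities of N2-ter §C price E5′-ms TOKEN FOR TOKEN at `D := 2ν` (the gate's dedup linter refuses their restatement,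
journal l.7759), so the budget's content ON THIS FACE is the END-LEVEL COMPOSITION: E5′-ms displays the KP size constant `a₁`, the
Lipschitz scales `lip k ≤ lipbar` and SIX scalar binders tying them to the table letters (`ε′ k` the (2.38)-TYPE majorant scale, `α4 k`
the (2.20)-TYPE table scale, `τ̄`, `ω`, the decay-weight rate `a″`, the majorant's d-rate `a′`).  Choosing (§1)
`a₁⋆ := 2e(2ν+1)·2^(2^ν)·2^(ν+1+2^ν)·ε̄·e^{a″(ν+1)}` and `lip k = lipbar := ᾱ·2^(ν+1+2^ν)` for sup letters `ε′ k ≤ ε̄`, `α4 k ≤ ᾱ`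
discharges all six from: the ONE exponential smallness `hKP : 2^(ν+1)·e·(2ν+1)·2^(2^ν)·2^(ν+1+2^ν)·ε̄·e^{a″(ν+1)} ≤ 1` (TYPE of
[II] p. 18 «Assuming 2E₀ε₁C₁α₄⁻¹α₆⁻¹M^q exp C₂κ₁ exp 5κ ≤ 1», `ν + 1 = 5`), the ADDITIVE letter-free rate condition
`hrate : a″ + 1 + 2^(ν+1)·log 2 + log(8ν) ≤ a′` (F-ne9leaf01-1 (R): no division by `2^ν`), positivity of `ω` and `ᾱ`; the envelope
`B = a₁⋆·e^{−a″(ν+1)} = 2e(2ν+1)·2^(2^ν)·2^(ν+1+2^ν)·ε̄` is EXPONENTIAL-FREE (TYPE p. 21 «O(1)C₃ε₁ ≦ ½E₀»), and the END's rate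
letter becomes **`μ⋆ = ω + 8e(2ν+1)·2^(2^ν)·(2^(ν+1+2^ν))²·ᾱ·ε̄·τ̄`** — POLYNOMIAL in `ᾱ, ε̄, τ̄`, no `e^{a}`, `e^{a′}`, `e^{a″}`,
`e^{κ}` (F-ne9leaf01-1 (P) repaired at the END level); fading `μ⋆ < 1` is the polynomial condition of §C `fade_necessary_E5'` /
`fade_sufficient_E5'` (T⁴: `72e·2^58·ᾱ·ε̄·τ̄ < 1 − ω`).  `ω` stays a LETTER (`0 < ω`; per the owner's located finding F-ne9p1g23-1
instantiate `ω := L^{−α}`, `NE9Lemma1Gain.rpow_neg_pos_lt_one`).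

WHAT IS PROVED (kernel).
§1 `two_pow_mul_aStar_le_one`, `smallness_of_printShaped` (E5′-ms's `hsmall` at every `k` from `hKP` and `ε′ k ≤ ε̄`),
   `rate_of_printShaped` (E5′-ms's `hrate` from the letter-free one), `aStar_envelope` (`B = 2e(2ν+1)·Q·P·ε̄`), `rateLetter_printShaped`
   (`ω + 4·lipbar·B·τ̄ = μ⋆`) — over a generic degree letter `Dp ≥ 0` (the face uses `Dp = 2ν + 1`).
§2 **`msChart_termSize_ne9_and_fadingMemory_printShaped`** — E5′-ms with `a₁ lip lipbar ha₁ hlip hlipb hliplb hsmall hpos hrate` GONE,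
   `hNsucc` re-lettered with the exponential-free envelope, displayed instead `hα4b hαbar hε'b hKP hrate (hω : 0 < ω)`; conclusion
   `TermSize E W κ N ∧ NE9 E W κ (prodModuli ℓ fun _ => μ⋆) ∧ FadingMemory (ℓ/μ⋆) μ⋆ (prodModuli ℓ fun _ => μ⋆)`; every other binder
   of p211220 VERBATIM, fed positionally.  §3 T⁴ numerals (`example`s): `μ⋆ − ω = 72e·2^58·ᾱ·ε̄·τ̄`, KP constant `288e·2^37`, envelope
   `18e·2^37·ε̄`.
DISGUISE TEST.  Scalars only; every displayed analytic binder is a ONE-history statement at the occurring coupling — not NE9 in disguise.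

References (TYPES only): [Balaban1988RG2Cluster] T. Bałaban, CMP 116 (1988) (1.26) p. 8, (2.18)–(2.20) p. 16, (2.27)/(2.29)–(2.30) p. 18
and p. 18 text «exp 5κ ≤ 1», Lemma 3 (2.38) p. 20, (2.40)–(2.41) p. 21 and p. 21 text «O(1)C₃ε₁ ≦ ½E₀»; [Balaban1987RG1] CMP 109 (1987)
(0.29)–(0.30) p. 258, p. 251, p. 257; [KoteckyPreiss1986] CMP 103 (1986) (1)–(3).
-/

noncomputable section
namespace Summit.QuantumFields.BalabanUV.T4Continuum.NE9LinSizeEndMultiScaleBudget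

open scoped BigOperators
open MeasureTheory BoundedContinuousFunction
open Literature.Probability.LatticeModels
open Literature.MathematicalPhysics.QuantumFieldTheory
open Literature.MathematicalPhysics.QuantumFieldTheory.Balaban1983to89
open Literature.MathematicalPhysics.QuantumFieldTheory.Balaban1983to89.T4OutputRate
open Literature.MathematicalPhysics.QuantumFieldTheory.Balaban1983to89.T4ActivityLipschitz
open Literature.MathematicalPhysics.QuantumFieldTheory.Balaban1983to89.T4HistoryLipschitzRecursion
open Literature.MathematicalPhysics.QuantumFieldTheory.Balaban1983to89.T4HistoryLipschitzOuter
open Literature.MathematicalPhysics.QuantumFieldTheory.Balaban1983to89.T4HistoryLipschitzActivity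
open Literature.MathematicalPhysics.QuantumFieldTheory.Balaban1983to89.T4HistoryLipschitzEntropy
open Literature.MathematicalPhysics.QuantumFieldTheory.Balaban1983to89.T4HistoryLipschitzCubeGeometry
open Literature.MathematicalPhysics.QuantumFieldTheory.Balaban1983to89.T4HistoryLipschitzSegment
open Literature.MathematicalPhysics.QuantumFieldTheory.Balaban1983to89.T4HistoryLipschitzLinearSize
open Summit.QuantumFields.BalabanUV.T4Continuum.NE9MultiScaleChart
open Summit.QuantumFields.BalabanUV.T4Continuum.NE9LinSizeKPMultiScale
open Summit.QuantumFields.BalabanUV.T4Continuum.NE9LinSizeEndMultiScale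
open Summit.QuantumFields.BalabanUV.T4Continuum.NE9LinSizeEndBudget (exp_two_pow_mul_add_log_two)

/-! ## §1 The print-shaped scalars: `a₁⋆`, its envelope, the discharged `hsmall` / `hrate`, the rate letter -/

section Scalars

variable {ν : ℕ} {Dp a' a'' εbar ε αbar τbar ω : ℝ}

/-- **`2^ν·a₁⋆ ≤ 1` IS the print-shaped KP smallness**: with `a₁⋆ := 2e·Dp·2^(2^ν)·2^(ν+1+2^ν)·ε̄·e^{a″(ν+1)}`,
`2^ν·a₁⋆ = 2^(ν+1)·e·Dp·2^(2^ν)·2^(ν+1+2^ν)·ε̄·e^{a″(ν+1)}`. [folklore] -/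
theorem two_pow_mul_aStar_le_one
    (hKP : 2 ^ (ν + 1) * Real.exp 1 * Dp * (2:ℝ) ^ (2 ^ ν) * 2 ^ (ν + 1 + 2 ^ ν) * εbar * Real.exp (a'' * (ν + 1)) ≤ 1) :
    2 ^ ν * (2 * Real.exp 1 * Dp * (2:ℝ) ^ (2 ^ ν) * 2 ^ (ν + 1 + 2 ^ ν) * εbar * Real.exp (a'' * (ν + 1))) ≤ 1 := by
  have e : 2 ^ ν * (2 * Real.exp 1 * Dp * (2:ℝ) ^ (2 ^ ν) * 2 ^ (ν + 1 + 2 ^ ν) * εbar * Real.exp (a'' * (ν + 1))) =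
      2 ^ (ν + 1) * Real.exp 1 * Dp * (2:ℝ) ^ (2 ^ ν) * 2 ^ (ν + 1 + 2 ^ ν) * εbar * Real.exp (a'' * (ν + 1)) := by ring
  rw [e]; exact hKP

/-- **E5′(-ms)'s `hsmall` DISCHARGED (kernel, real arithmetic).**  For `0 ≤ ε ≤ ε̄`, `0 ≤ Dp` and the print-shaped KP smallness:
`Dp·(2ε)·e^{a″(ν+1) + 2^ν(a₁⋆ + log 2)}·2^(ν+1+2^ν) ≤ a₁⋆` — the face's smallness binder at the step scale `ε = ε′ k` (`e^{2^ν a₁⋆} ≤ e`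
by `two_pow_mul_aStar_le_one`, `e^{2^ν log 2} = 2^(2^ν)`); the recipe of `NE9LinSizeEndBudget.fade_sufficient_E5'`, letters explicit.
[folklore] -/
theorem smallness_of_printShaped (hDp : 0 ≤ Dp) (hε0 : 0 ≤ ε) (hε : ε ≤ εbar)
    (hKP : 2 ^ (ν + 1) * Real.exp 1 * Dp * (2:ℝ) ^ (2 ^ ν) * 2 ^ (ν + 1 + 2 ^ ν) * εbar * Real.exp (a'' * (ν + 1)) ≤ 1) :
    Dp * (2 * ε) * Real.exp (a'' * (ν + 1) + 2 ^ ν *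
        (2 * Real.exp 1 * Dp * (2:ℝ) ^ (2 ^ ν) * 2 ^ (ν + 1 + 2 ^ ν) * εbar * Real.exp (a'' * (ν + 1)) + Real.log 2)) *
      2 ^ (ν + 1 + 2 ^ ν) ≤
      2 * Real.exp 1 * Dp * (2:ℝ) ^ (2 ^ ν) * 2 ^ (ν + 1 + 2 ^ ν) * εbar * Real.exp (a'' * (ν + 1)) := by
  set P : ℝ := 2 ^ (ν + 1 + 2 ^ ν) with hP
  set Q : ℝ := (2:ℝ) ^ (2 ^ ν) with hQ
  set A : ℝ := 2 * Real.exp 1 * Dp * Q * P * εbar * Real.exp (a'' * (ν + 1)) with hA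
  have hP0 : 0 < P := by positivity
  have hQ0 : 0 < Q := by positivity
  have h1 : 2 ^ ν * A ≤ 1 := two_pow_mul_aStar_le_one hKP
  have hQe : Real.exp (2 ^ ν * Real.log 2) = Q := by
    have h := exp_two_pow_mul_add_log_two ν 0
    rw [mul_zero, Real.exp_zero, one_mul, zero_add] at h
    exact h
  have h2 : Real.exp (a'' * (ν + 1) + 2 ^ ν * (A + Real.log 2)) ≤ Real.exp (a'' * (ν + 1)) * Real.exp 1 * Q := by
    rw [show a'' * (ν + 1) + 2 ^ ν * (A + Real.log 2) = a'' * (ν + 1) + 2 ^ ν * A + 2 ^ ν * Real.log 2 by ring,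
      Real.exp_add, Real.exp_add, hQe]
    have h3 : Real.exp (2 ^ ν * A) ≤ Real.exp 1 := Real.exp_le_exp.2 h1
    exact mul_le_mul_of_nonneg_right (mul_le_mul_of_nonneg_left h3 (Real.exp_pos _).le) hQ0.le
  have hc1 : Dp * (2 * ε) ≤ Dp * (2 * εbar) := mul_le_mul_of_nonneg_left (by linarith) hDp
  have hc1' : 0 ≤ Dp * (2 * εbar) := mul_nonneg hDp (by linarith)
  calc Dp * (2 * ε) * Real.exp (a'' * (ν + 1) + 2 ^ ν * (A + Real.log 2)) * P
      ≤ Dp * (2 * εbar) * (Real.exp (a'' * (ν + 1)) * Real.exp 1 * Q) * P :=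
        mul_le_mul_of_nonneg_right (mul_le_mul hc1 h2 (Real.exp_pos _).le hc1') hP0.le
    _ = A := by rw [hA]; ring

/-- **E5′(-ms)'s `hrate` DISCHARGED from the letter-free ADDITIVE condition (kernel).**  `a″ + 1 + 2^(ν+1)·log 2 + log(8ν) ≤ a′` and
`2^ν·a₁⋆ ≤ 1` give the face's `2^ν·log 2 + log(8ν) ≤ a′ − a″ − 2^ν·(a₁⋆ + log 2)`. [folklore] -/
theorem rate_of_printShaped
    (hKP : 2 ^ (ν + 1) * Real.exp 1 * Dp * (2:ℝ) ^ (2 ^ ν) * 2 ^ (ν + 1 + 2 ^ ν) * εbar * Real.exp (a'' * (ν + 1)) ≤ 1)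
    (hrate : a'' + 1 + 2 ^ (ν + 1) * Real.log 2 + Real.log (8 * ν) ≤ a') :
    (2:ℝ) ^ ν * Real.log 2 + Real.log (8 * ν) ≤ a' - a'' -
      2 ^ ν * (2 * Real.exp 1 * Dp * (2:ℝ) ^ (2 ^ ν) * 2 ^ (ν + 1 + 2 ^ ν) * εbar * Real.exp (a'' * (ν + 1)) + Real.log 2) := by
  have h1 := two_pow_mul_aStar_le_one hKP
  have e : (2:ℝ) ^ (ν + 1) * Real.log 2 = 2 * ((2:ℝ) ^ ν * Real.log 2) := by ring
  rw [e] at hrate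
  rw [mul_add]
  linarith

/-- **THE ENVELOPE IS EXPONENTIAL-FREE**: `a₁⋆·e^{−a″(ν+1)} = 2e·Dp·2^(2^ν)·2^(ν+1+2^ν)·ε̄` — the `e^{a″(ν+1)}` (print's `e^{5κ}`)
cancels; this is the size-induction increment `B` of the face (TYPE [II] p. 21 «O(1)C₃ε₁ ≦ ½E₀»). [folklore] -/
theorem aStar_envelope (ν : ℕ) (Dp a'' εbar : ℝ) :
    2 * Real.exp 1 * Dp * (2:ℝ) ^ (2 ^ ν) * 2 ^ (ν + 1 + 2 ^ ν) * εbar * Real.exp (a'' * (ν + 1)) *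
        Real.exp (-(a'' * (ν + 1))) =
      2 * Real.exp 1 * Dp * (2:ℝ) ^ (2 ^ ν) * 2 ^ (ν + 1 + 2 ^ ν) * εbar := by
  have h : Real.exp (a'' * (ν + 1)) * Real.exp (-(a'' * (ν + 1))) = 1 := by
    rw [← Real.exp_add, add_neg_cancel, Real.exp_zero]
  calc 2 * Real.exp 1 * Dp * (2:ℝ) ^ (2 ^ ν) * 2 ^ (ν + 1 + 2 ^ ν) * εbar * Real.exp (a'' * (ν + 1)) *
          Real.exp (-(a'' * (ν + 1)))
      = 2 * Real.exp 1 * Dp * (2:ℝ) ^ (2 ^ ν) * 2 ^ (ν + 1 + 2 ^ ν) * εbar *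
          (Real.exp (a'' * (ν + 1)) * Real.exp (-(a'' * (ν + 1)))) := by ring
    _ = _ := by rw [h, mul_one]

/-- **THE RATE LETTER IS POLYNOMIAL**: with `lipbar := ᾱ·2^(ν+1+2^ν)` and `B = a₁⋆·e^{−a″(ν+1)}`, the END's
`ω + 4·lipbar·B·τ̄ = ω + 8e·Dp·2^(2^ν)·(2^(ν+1+2^ν))²·ᾱ·ε̄·τ̄`. [folklore] -/
theorem rateLetter_printShaped (ν : ℕ) (Dp a'' εbar αbar τbar ω : ℝ) :
    ω + 4 * (αbar * 2 ^ (ν + 1 + 2 ^ ν)) *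
        (2 * Real.exp 1 * Dp * (2:ℝ) ^ (2 ^ ν) * 2 ^ (ν + 1 + 2 ^ ν) * εbar * Real.exp (a'' * (ν + 1)) *
          Real.exp (-(a'' * (ν + 1)))) * τbar =
      ω + 8 * Real.exp 1 * Dp * (2:ℝ) ^ (2 ^ ν) * (2 ^ (ν + 1 + 2 ^ ν)) ^ 2 * αbar * εbar * τbar := by
  rw [aStar_envelope]; ring

end Scalars

/-! ## §2 E5′-ms IN PRINT-SHAPED LETTERS -/

section Chart

variable (ν : ℕ) (n : ℕ → ℕ) [∀ k, NeZero (n k)]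
variable (BgA BgB : Type) (gauge : BgA → BgA → ℝ) (gauge_nonneg : ∀ U U', 0 ≤ gauge U U') (transport : BgB → BgA)
variable {Bg : Type} {Sp : Type*} [TopologicalSpace Sp] [MeasurableSpace Sp] [OpensMeasurableSpace Sp] {F : Type*}
  [Fintype F] {Ω : Type*} [MeasurableSpace Ω]

/-- **E5′-ms IN PRINT-SHAPED LETTERS (kernel end-to-end).**  `NE9LinSizeEndMultiScale.msChart_termSize_ne9_and_fadingMemory_of_linSizeDischargers`
(p211220) with its bookkeeping scalars CHOSEN — `a₁ := a₁⋆ = 2e(2ν+1)·2^(2^ν)·2^(ν+1+2^ν)·ε̄·e^{a″(ν+1)}`, `lip k = lipbar := ᾱ·2^(ν+1+2^ν)`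
— so that the letters `a₁ lip lipbar` and the binders `ha₁ hlip hlipb hliplb hsmall hpos hrate` are GONE; DISPLAYED instead: sup
letters `hε'b : ε′ k ≤ ε̄`, `hα4b : α4 k ≤ ᾱ`, `hαbar : 0 < ᾱ`, the ONE exponential smallness **`hKP : 2^(ν+1)·e·(2ν+1)·2^(2^ν)·
2^(ν+1+2^ν)·ε̄·e^{a″(ν+1)} ≤ 1`** (TYPE [II] p. 18 «… exp C₂κ₁ exp 5κ ≤ 1», `ν + 1 = 5`), the ADDITIVE letter-free rate condition
**`hrate : a″ + 1 + 2^(ν+1)·log 2 + log(8ν) ≤ a′`**, `hω : 0 < ω`, and (N) with the exponential-free increment **`hNsucc : p₀ j +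
2e(2ν+1)·2^(2^ν)·2^(ν+1+2^ν)·ε̄ ≤ N (j+1)`** (TYPE p. 21 «O(1)C₃ε₁ ≦ ½E₀»); every other binder of p211220 VERBATIM (recursion side,
(B0)/(X)/(R′), regularity, `hmeet`, (lip) `ha`, (L‴) `hlin`/`hdomconn`/`hdominj`, (A″) `hdecayLin` in `d_k`, `ha″`, `hκa : κ ≤ a″`,
`hℓ hτbar hlam hτ`).  Conclusion: `TermSize E W κ N` and the END with the POLYNOMIAL rate letter **`μ⋆ = ω + 8e(2ν+1)·2^(2^ν)·
(2^(ν+1+2^ν))²·ᾱ·ε̄·τ̄`** — no `e^{a}`, `e^{a′}`, `e^{a″}`, `e^{κ}` anywhere in the face (F-ne9leaf01-1 (R)(P) repaired at the END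
level); fading `μ⋆ < 1` is `NE9LinSizeEndBudget.fade_necessary_E5'`'s polynomial condition (T⁴: `72e·2^58·ᾱ·ε̄·τ̄ < 1 − ω`), and
the scalar choices are `fade_sufficient_E5'`'s.  Composition BY NAME: p211220 ∘ §1.  (A″)/(L‴)/the recursion side DISPLAYED, nothing
of [I]–[III] asserted; rung (B)+1 bookkeeping on a finite torus.
[cite: Balaban1988RG2Cluster, p.18 text, (2.29)-(2.30) p.18, Lemma 3 (2.38) p.20, (2.40)-(2.41) p.21 and p.21 text, (1.26) p.8, (2.18)-(2.20) p.16; Balaban1987RG1, p.251, p.257; KoteckyPreiss1986, (1)-(3)] -/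
theorem msChart_termSize_ne9_and_fadingMemory_printShaped
    {ι : Type} {E : Functional (msCarriers ν n BgA BgB gauge gauge_nonneg transport) Bg}
    {W : Set (ℕ → ℝ)} {Adm : Set (Bg → (msCarriers ν n BgA BgB gauge gauge_nonneg transport).Dom → ℝ)}
    {T : ℕ → (ℕ → ℝ) → (Bg → (msCarriers ν n BgA BgB gauge gauge_nonneg transport).Dom → ℝ) → ι → ℝ}
    {Ψ : ℕ → ℝ → (ι → ℝ) → Bg → (msCarriers ν n BgA BgB gauge gauge_nonneg transport).Dom → ℝ}
    {μ : ℕ → ℝ → Bg → Finset (Site ν n) → Measure Ω} {pre : ℕ → ℝ → Bg → Finset (Site ν n) → Ω → ℂ}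
    {c : ℕ → ℝ → Bg → Finset (Site ν n) → Ω → F → ℂ}
    {pt : ℕ → ℝ → Bg → Finset (Site ν n) → Ω → F → Sp} {β : ℕ → Sp → ℝ}
    {dom : ℕ → Finset (Site ν n) → F → Finset (Site ν n)}
    {ε' α4 : ℕ → ℝ} {a'' κ ℓ τbar ω a a' εbar αbar : ℝ} {wt : ℕ → ι → ℝ} {τ : ℕ → ℕ → ℝ} {lam p₀ Nsz : ℕ → ℝ}
    (ρ : ℕ → (ι → ℝ) → (Sp →ᵇ ℂ))
    -- recursion side (displayed, named binders of the P2 leaves)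
    (h0 : ScaleZeroFree E W) (hAdm : AdmissibleTerms E W Adm) (hres : AdmRestrict Adm)
    (hadd : ChannelAdditive Adm T) (hsum : ChannelStepSum Adm T) (hstep : ChannelSizeAtStepNN Adm T κ wt τ)
    (hfac : Factorises E W T Ψ) (hlast : LastCouplingLipschitz E W T Ψ κ lam)
    (hρ : ∀ (k : ℕ) (P P' : ι → ℝ) (M : ℝ), (∀ y, |P y - P' y| ≤ wt k y * M) → ‖ρ k P - ρ k P'‖ ≤ M)
    (hΨ : ∀ (k : ℕ) (s : ℝ) (P P' : ι → ℝ) (U : Bg) (X : (msCarriers ν n BgA BgB gauge gauge_nonneg transport).Dom),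
      Ψ k s P U X - Ψ k s P' U X =
        ((msChart ν n BgA BgB gauge gauge_nonneg transport).geom.newTerm
            ((msChart ν n BgA BgB gauge gauge_nonneg transport).geom.avgExpLinearAct μ pre fun k s U γ ω =>
              evalFunctional (c k s U γ ω) (pt k s U γ ω)) k s U X (ρ k P) -
          (msChart ν n BgA BgB gauge gauge_nonneg transport).geom.newTerm
            ((msChart ν n BgA BgB gauge gauge_nonneg transport).geom.avgExpLinearAct μ pre fun k s U γ ω =>
              evalFunctional (c k s U γ ω) (pt k s U γ ω)) k s U X (ρ k P')).re)
    -- the size-induction data (B0), (X), (N) with the EXPONENTIAL-FREE increment B = 2e(2ν+1)·2^(2^ν)·2^(ν+1+2^ν)·ε̄, (R′)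
    (hexpl : ∀ g ∈ W, ∀ (k : ℕ) (P : ι → ℝ) (U : Bg) (X : (msCarriers ν n BgA BgB gauge gauge_nonneg transport).Dom),
      (msCarriers ν n BgA BgB gauge gauge_nonneg transport).scale X = k + 1 →
      |Ψ k (g k) P U X -
          ((msChart ν n BgA BgB gauge gauge_nonneg transport).geom.newTerm
            ((msChart ν n BgA BgB gauge gauge_nonneg transport).geom.avgExpLinearAct μ pre fun k s U γ ω =>
              evalFunctional (c k s U γ ω) (pt k s U γ ω)) k (g k) U X (ρ k P)).re| ≤
        Real.exp (-(κ * (msCarriers ν n BgA BgB gauge gauge_nonneg transport).d X)) * p₀ k)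
    (hbase : ∀ g ∈ W, ∀ (U : Bg) (X : (msCarriers ν n BgA BgB gauge gauge_nonneg transport).Dom),
      (msCarriers ν n BgA BgB gauge gauge_nonneg transport).scale X = 0 →
      |E g U X| ≤ Real.exp (-(κ * (msCarriers ν n BgA BgB gauge gauge_nonneg transport).d X)) * Nsz 0)
    (hNsucc : ∀ j, p₀ j + 2 * Real.exp 1 * ((((2 * ν : ℕ) : ℝ)) + 1) * (2:ℝ) ^ (2 ^ ν) * 2 ^ (ν + 1 + 2 ^ ν) * εbar ≤
      Nsz (j + 1))
    (hNnn : ∀ j, 0 ≤ Nsz j)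
    (hbox : ∀ (k : ℕ) (P : ι → ℝ), (∀ y, |P y| ≤ wt k y * sizeRadius τ Nsz k) → ∀ x, ‖ρ k P x‖ ≤ β k x)
    -- activity side: regularity data, ONE integrability, support of the coefficients
    (hpre : ∀ k s U γ, AEStronglyMeasurable (pre k s U γ) (μ k s U γ))
    (hc : ∀ k s U γ Y, AEStronglyMeasurable (fun ω => c k s U γ ω Y) (μ k s U γ))
    (hpt : ∀ k s U γ Y, Measurable fun ω => pt k s U γ ω Y)
    (hint₀ : ∀ k s U γ, Integrable (fun ω => ‖pre k s U γ ω‖ * Real.exp (boxExponent c pt β k s U γ ω)) (μ k s U γ))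
    (hmeet : ∀ k s U (γ : Finset (Site ν n)) ω Y, c k s U γ ω Y ≠ 0 → ∃ x ∈ γ, x ∈ dom k γ Y)
    -- (L‴) decay of the coefficient tables in d_k with a SUP LETTER for the table scale (TYPE (2.20): α₄ is one constant)
    (hα4 : ∀ k, 0 ≤ α4 k) (hα4b : ∀ k, α4 k ≤ αbar) (hαbar : 0 < αbar)
    (ha : (2:ℝ) ^ ν * Real.log 2 + Real.log (8 * ν) ≤ a)
    (hlin : ∀ k s U (γ : Finset (Site ν n)) ω Y,
      ‖c k s U γ ω Y‖ ≤ α4 k * Real.exp (-(a * (msLinSize (n := n) (dom k γ Y) : ℝ))))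
    (hdomconn : ∀ k (γ : Finset (Site ν n)) Y, (dom k γ Y).Nonempty →
      ∃ b ∈ dom k γ Y, Polymer.IsConn (SAdj ν n) (dom k γ Y) b)
    (hdominj : ∀ k (γ : Finset (Site ν n)), Set.InjOn (dom k γ) {Y | (dom k γ Y).Nonempty})
    -- (A″) decay of the box majorant in d_k (TYPE (2.38)) with a SUP LETTER for its scale (ε₁ is one constant)
    (hε' : ∀ k, 0 ≤ ε' k) (hε'b : ∀ k, ε' k ≤ εbar)
    (hdecayLin : ∀ g ∈ W, ∀ (k : ℕ) (U : Bg) (X : (msCarriers ν n BgA BgB gauge gauge_nonneg transport).Dom),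
      (msCarriers ν n BgA BgB gauge gauge_nonneg transport).scale X = k + 1 →
      ∀ γ' ∈ (msChart ν n BgA BgB gauge gauge_nonneg transport).vol X,
        ∫ ω, ‖pre k (g k) U γ' ω‖ * Real.exp (boxExponent c pt β k (g k) U γ' ω) ∂(μ k (g k) U γ') ≤
          ε' k * Real.exp (-(a' * (msLinSize (n := n) γ' : ℝ))))
    (ha'' : 0 ≤ a'') (hκa : κ ≤ a'')
    -- THE PRINT-SHAPED SCALARS: the one exponential smallness (TYPE p.18 «exp 5κ ≤ 1») and the ADDITIVE letter-free rate condition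
    (hKP : 2 ^ (ν + 1) * Real.exp 1 * ((((2 * ν : ℕ) : ℝ)) + 1) * (2:ℝ) ^ (2 ^ ν) * 2 ^ (ν + 1 + 2 ^ ν) * εbar *
      Real.exp (a'' * (ν + 1)) ≤ 1)
    (hrate : a'' + 1 + 2 ^ (ν + 1) * Real.log 2 + Real.log (8 * ν) ≤ a')
    -- envelope data (`ω` a LETTER; instantiate `ω := L^{−α}`)
    (hℓ : 0 ≤ ℓ) (hτbar : 0 ≤ τbar) (hω : 0 < ω)
    (hlam : ∀ k, lam k ≤ ℓ) (hτ : ∀ k j, j ≤ k → 0 ≤ τ k j ∧ τ k j ≤ τbar * ω ^ (k - j)) :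
    TermSize E W κ Nsz ∧
      NE9 E W κ (prodModuli ℓ fun _ =>
        ω + 8 * Real.exp 1 * ((((2 * ν : ℕ) : ℝ)) + 1) * (2:ℝ) ^ (2 ^ ν) * (2 ^ (ν + 1 + 2 ^ ν)) ^ 2 * αbar * εbar * τbar) ∧
        FadingMemory
          (ℓ / (ω + 8 * Real.exp 1 * ((((2 * ν : ℕ) : ℝ)) + 1) * (2:ℝ) ^ (2 ^ ν) * (2 ^ (ν + 1 + 2 ^ ν)) ^ 2 * αbar * εbar *
            τbar))
          (ω + 8 * Real.exp 1 * ((((2 * ν : ℕ) : ℝ)) + 1) * (2:ℝ) ^ (2 ^ ν) * (2 ^ (ν + 1 + 2 ^ ν)) ^ 2 * αbar * εbar * τbar)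
          (prodModuli ℓ fun _ =>
            ω + 8 * Real.exp 1 * ((((2 * ν : ℕ) : ℝ)) + 1) * (2:ℝ) ^ (2 ^ ν) * (2 ^ (ν + 1 + 2 ^ ν)) ^ 2 * αbar * εbar *
              τbar) := by
  have hDp : (0:ℝ) ≤ (((2 * ν : ℕ) : ℝ)) + 1 := by positivity
  have hεbar : 0 ≤ εbar := (hε' 0).trans (hε'b 0)
  have hP0 : (0:ℝ) < 2 ^ (ν + 1 + 2 ^ ν) := by positivity
  -- the chosen KP size constant `a₁⋆` and its discharged binders
  have hA0 : 0 ≤ 2 * Real.exp 1 * ((((2 * ν : ℕ) : ℝ)) + 1) * (2:ℝ) ^ (2 ^ ν) * 2 ^ (ν + 1 + 2 ^ ν) * εbar *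
      Real.exp (a'' * (ν + 1)) := by positivity
  have hsmall := fun k => smallness_of_printShaped (ν := ν) hDp (hε' k) (hε'b k) hKP
  have hrate' := rate_of_printShaped (ν := ν) hKP hrate
  have eμ := rateLetter_printShaped ν ((((2 * ν : ℕ) : ℝ)) + 1) a'' εbar αbar τbar ω
  have hpos : 0 < ω + 4 * (αbar * 2 ^ (ν + 1 + 2 ^ ν)) *
      (2 * Real.exp 1 * ((((2 * ν : ℕ) : ℝ)) + 1) * (2:ℝ) ^ (2 ^ ν) * 2 ^ (ν + 1 + 2 ^ ν) * εbar *
        Real.exp (a'' * (ν + 1)) * Real.exp (-(a'' * (ν + 1)))) * τbar := by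
    rw [eμ]
    have : 0 ≤ 8 * Real.exp 1 * ((((2 * ν : ℕ) : ℝ)) + 1) * (2:ℝ) ^ (2 ^ ν) * (2 ^ (ν + 1 + 2 ^ ν)) ^ 2 * αbar * εbar *
        τbar := by
      have := hαbar.le
      positivity
    linarith
  have h := msChart_termSize_ne9_and_fadingMemory_of_linSizeDischargers ν n BgA BgB gauge gauge_nonneg transport ρ h0 hAdm
    hres hadd hsum hstep hfac hlast hρ hΨ hexpl hbase
    (fun j => by rw [aStar_envelope]; exact hNsucc j) hNnn hbox hpre hc hpt
    (lip := fun _ => αbar * 2 ^ (ν + 1 + 2 ^ ν)) (lipbar := αbar * 2 ^ (ν + 1 + 2 ^ ν))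
    (fun _ => mul_pos hαbar hP0) (fun _ => le_rfl) hint₀ hmeet hα4 ha
    (fun k => mul_le_mul_of_nonneg_right (hα4b k) hP0.le) hlin hdomconn hdominj hε' hdecayLin hA0 ha'' hκa hrate' hsmall
    hℓ hτbar hω.le hpos hlam hτ
  rw [eμ] at h
  exact h

end Chart

/-! ## §3 T⁴ numerals (ν = 4, degree 2ν = 8): pure numbers, `norm_num` -/

/-- on T⁴ the polynomial rate letter reads `μ⋆ = ω + 72e·2^58·ᾱ·ε̄·τ̄` (`8·9·2^16·2^42`). [folklore] -/
example : (8:ℝ) * ((((2 * 4 : ℕ) : ℝ)) + 1) * (2:ℝ) ^ (2 ^ 4) * ((2:ℝ) ^ (4 + 1 + 2 ^ 4)) ^ 2 = 72 * 2 ^ 58 := by norm_num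

/-- on T⁴ the print-shaped KP smallness reads `288e·2^37·ε̄·e^{5a″} ≤ 1` (`2^5·9·2^16·2^21`), and `ν + 1 = 5`. [folklore] -/
example : (2:ℝ) ^ (4 + 1) * ((((2 * 4 : ℕ) : ℝ)) + 1) * (2:ℝ) ^ (2 ^ 4) * 2 ^ (4 + 1 + 2 ^ 4) = 288 * 2 ^ 37 ∧
    (((4:ℕ) : ℝ) + 1) = 5 := by
  constructor <;> norm_num

/-- on T⁴ the exponential-free size-induction increment reads `B = 18e·2^37·ε̄` (`2·9·2^16·2^21`). [folklore] -/
example : (2:ℝ) * ((((2 * 4 : ℕ) : ℝ)) + 1) * (2:ℝ) ^ (2 ^ 4) * 2 ^ (4 + 1 + 2 ^ 4) = 18 * 2 ^ 37 := by norm_num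

end Summit.QuantumFields.BalabanUV.T4Continuum.NE9LinSizeEndMultiScaleBudget

end
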